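import Summits.QuantumFields.YangMills.Theorems.UnitScaleTiltHalvingHSiteRowsOfSockets
import Summits.QuantumFields.YangMills.Theorems.UnitScaleTiltHalvingHSupURhoWindowsRho3
import HarnessLib

/-!
# Route `UnitScaleTilt`, crux K1 child «MinimiserStabilityRegPr» (stmt-QuantumFields-19200), registered stub `stub_halvingStep` (v10 `BirthV10`) —
# **LEAD-H (K-final, SOCKET layer at the step members): THE STEP PACK `PACK(2 ≤ K − n)` FROM THE N05∕N06 SOCKETS** — (k ≥ 2 composer)
# ★w3-19200 g8's `HalvingHSiteRowsOfSockets.siteRows_of_sockets` at the window letter `t := 0`, its numeric windows DISCHARGED from the window hand's smallness `hw`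
# (✓`HalvingHSupURhoWindowsRho3.exists_topCall_constants_of_rhoWindow₃` through the bridge; the torus package is consumed INSIDE that composer); displayed: the
# socket constants `B₀ B₀'H B₂' BG BR cB9 B₀β β` per `L` and the five sockets `hT4L` (Theorem 4's datum at `U′`, ∀ gJ-closed), `SB9L` (lit `SockB9P3`, `len`
# per cube family), `SLetτL` ([4] letters), `H42L`, `H59L` (the composer's texts VERBATIM, ∀-closed over the members under every member datum)

Cell `ym3-torus` (HUMAN RULING D-0037, YM ladder rung R3 — YM₃ on T³ is a RUNG, NOT the Clay problem), width seat `ym-ust-19200-w5` gen 5 (LEAD-H g5).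
`--supports stmt-QuantumFields-19200 --as helper`; count-neutral; def-free, 0 sorry, standard axioms; nothing here claims the stub, the crux, the rung or the gap.

INHABITABILITY (OWNER №9 (3)).  `hT4L` ⟸ the composer's own `hT4_of_rawSockets` from the (τ-D) driver's four raw sockets (as inhabitable as `H42L`); `SB9L`,
`SLetτL`, `H59L` = the [4] storey (Thm 3.1∕3.3, N05∕N06), bona fide; `H42L` = Prop. 3 (1.42): `j < K − n` by ✓`B8Eq142KLevelLocal.H42_of_inAx` + J3 (d), top level
OPEN (ε₁-route; LEAD-H LOCATE-H42-TOP) — see ✓`HalvingHMemberPackBaseOfSockets`'s docstring.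
References: [Balaban1985RegularSpaces] Prop. 3 pp.82–83, (1.59) p.87, Thm 4 p.88; [Balaban1985BackgroundPropagators] Thm 3.1∕3.3 pp.397–399; [Balaban1985Variational] (150)–(156).
-/

set_option autoImplicit false

noncomputable section

open scoped BigOperators Matrix.Norms.L2Operator
open NormedSpace
open Complex (I)

namespace Summit.QuantumFields.YangMills.Theorems.HalvingHMemberPackStepOfSockets

open Literature.MathematicalPhysics.QuantumFieldTheory.Balaban1983to89
open Literature.MathematicalPhysics.QuantumFieldTheory.Balaban1983to89.T3ContinuumYM3Torus
open Literature.MathematicalPhysics.QuantumFieldTheory.Balaban1983to89.T3PrintedRegularMinimiser (RegPr regFibrePr)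
open MatrixLog (mlog)
open B5Eq118OneStroke (iterBlockOf)
open B7Prop1Explicit (e expUnit)
open B7Prop1Explicit renaming Site → LSite
open B7Prop2Explicit (unitaryUnits C0 c2' avgIter)
open B7Prop2SpecialUnitary (specialUnitaryUnits mem_specialUnitaryUnits specialUnitaryUnits_le_unitaryUnits)
open B7Prop3Flat (c3)
open B7Prop10General (C6 C4G)
open B7Prop9Flat (C5')
open B7Prop1Local (InBox loK bondHiK)
open B7Eq78Linearization (conjR zdBlocking QprimeIter)
open B7Eq92Concrete (mgauge)
open B8Ineq130 (tlo thi)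
open B8Ineq132 (covDerivFwd InAk)
open B8Eq119TwistedAxial (Restr129 InAx bgT)
open B8Eq131Cubes (cube gs tLo tHi)
open B8Eq131CubesAdmissible (cubeFam)
open B8CubeMemberZd (cubeLamS cubeLamB)
open B8Eq184Proof (gaugeExp cfgExp)
open B8Eq182Proof (gAd)
open B8Eq188Proof (frakF3)
open B8Eq140Level (SideTouches)
open B8Eq146AExpansion (iEta)
open B8Eq138LandauZd (IsLandau138W covDivB covLap QT logCfg)
open B7Prop4GeneralLevels (logCovIter linCovIter)
open B8Eq155JBound (Jcur wsup)
open B8ScaledSupNorm (bondNorm msup)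
open B8Ineq125Concrete (C2p)
open B8Eq1117Concrete (XSpace)
open B8LeafModelZd3 (SockB9P3)
open B8Prop5ContractionKLevel (Bd2 Mc Kc)
open B8LambdaSpaceKLevel (wt)
open B8Eq178Averages (Qnl)
open B8SpecialUnitaryTrace (trCLM trCLM_apply)
open B10Eq27TorusAxialLog (transl rel pull pull_apply unitsField toUField suIncl gaugeActT axialT unitsField_mem_unitaryUnits)
open B15Eq112TorusCover (lift cover)
open Node00 (coverAt)
open LatticeFieldCalculus (siteAvgIter)
open Summit.QuantumFields.YangMills.Theorems.Prop8ChartDoubleBar (dbarIterU vframeU)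
open P1FlatCoreCubeInclusion (corner_of_offset)
open HalvingP1FlatCoreSupplierAssembly (hchartTop_of_hdat hc₁_of_small)
open HalvingHSiteSizeRowsOfTopRows (siteSizeRows_of_topRows)
open HalvingHSiteTopKnit (hknit_of_descent)
open HalvingHSiteDatumOfSockets (siteDatum_of_T4)
open HalvingHSiteTopOfDatum (siteTop_of_datum)
open HalvingHSiteRowsOfSockets (siteRows_of_sockets)
open P1FlatCoreCubeInclusion (corner_of_offset room_of_level_k)
open HalvingHSupURhoWindowsRho3 (exists_topCall_constants_of_rhoWindow₃)

/-- ★★★ **THE STEP PACK FROM THE SOCKETS.**  See the module docstring: per `L` the constants `B₀`, `Cw :=` the window hand's factor, `Mₚ := 1`; per member with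
`2 ≤ K − n`: ✓`siteRows_of_sockets` at `t := 0` with its windows from `hw`.
[cite: Balaban1985RegularSpaces, Prop. 3 (1.36)-(1.42) pp.82-83, Thm 4 p.88; Balaban1985BackgroundPropagators, Thm 3.1 p.397, Thm 3.3 p.399; Balaban1985Variational, (150)-(156) pp.301-302] -/
theorem memberPack_step_of_sockets (M' : ℕ) (hM' : 1 ≤ M')
    (hSockets₂ : ∀ L : ℕ, Odd L → 1 < L → ∃ (B₀ B₀'H B₂' BG BR cB9 B₀β β : ℝ), 0 < B₀ ∧ 0 < B₀'H ∧ 0 ≤ B₂' ∧ 0 ≤ BG ∧ 0 ≤ BR ∧ 0 < cB9 ∧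
        -- `hT4L`: Theorem 4's datum at `U′ := pull (U^{gJ})♯ 0` at every level (∀ gJ-closed), under every member datum and the schedule's letters
        (∀ (F : T3Family), F.L = L → ∀ (n K : ℕ) (hnK : n < K) (ρ S M ρ' : ℕ), ρ' = ρ + M + L + S → 1 ≤ M → 2 ≤ S →
          ∀ (a₅ Cr ε₀ ε₁ : ℝ), 0 < Cr → 12 * ((ρ : ℝ) + (M : ℝ)) * a₅ ≤ Cr → 0 < ε₁ → 0 < ε₀ → ε₀ ≤ a₅ → Cr * ε₁ ≤ ε₀ →
          (10 : ℝ) ^ 29 * (L : ℝ) ^ 12 * (1 + B₀ + B₀⁻¹) ^ 2 * ((1 + B₀'H) * (1 + B₂') * (1 + BG) * (1 + BR)) ^ 5 * (1 + cB9⁻¹) *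
            ((((ρ + M + L + S : ℕ) : ℝ) + (M' : ℝ) + 1) ^ 3 * ε₀) ≤ 1 →
          2 * ρ + (M' + 1 + 2 * (M + L + S)) ≤ F.L ^ (F.m + n) →
          ∀ (V : GaugeField (F.P n) 0 (Matrix.specialUnitaryGroup (Fin 2) ℂ)), PlaqSmall ε₁ V → ∀ U ∈ regFibrePr F n K hnK.le ε₀ V,
          ∀ (x₀ : Site (F.P K) 0) (t : ℤ), 0 ≤ t → t ≤ (M' : ℤ) - 1 →
          ∀ (a : LSite (F.P K).d), a = (fun μ => ((iterBlockOf (K - n) x₀ μ).val : ℤ) - t) →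
          ∀ (α₁ α₄ cstar : ℝ), α₁ = 198 * (((ρ' : ℝ) + M' + 1) * ε₀) + 27 * (((ρ' : ℝ) + M' + 1) * ε₀) / ((L : ℝ) * B₀) →
          cstar = 5 * (F.P K).d * (F.P K).L * B₀ * (ε₀ + α₁) →
          α₄ = 8 * (300 * (L : ℝ) * ((3 * (M' + ρ') + 1 : ℕ) : ℝ) * (B₀'H + 15 * (L : ℝ) ^ 2 * BG * BR + 3 * BG * BR * B₂')) * (5 * ((3 : ℕ) : ℝ) * L * B₀) * (ε₀ + α₁) →
          ∀ (s : ℝ), s = (198 + 12 * (((M' : ℝ) - 1) + 4 * ρ')) * ε₀ →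
          ∀ gJ : GaugeTransf (F.P K) 0 (Matrix.specialUnitaryGroup (Fin 2) ℂ),
          InAk (F.P K).L (K - n) (((F.L : ℝ)⁻¹) ^ (K - n)) ε₀ (fun _ => (Set.univ : Set (LSite (F.P K).d))) (pull (unitsField (toUField (GaugeField.gaugeAct gJ U))) 0) →
          (∀ (x : LSite (F.P K).d) (ν : Fin (F.P K).d), tlo (F.P K).L (tLo a ρ') (K - n) ≤ x → x + e ν ≤ thi (F.P K).L (tHi a M' ρ') (K - n) →
          ‖((pull (unitsField (toUField (GaugeField.gaugeAct gJ U))) 0 x ν : (Matrix (Fin 2) (Fin 2) ℂ)ˣ) : Matrix (Fin 2) (Fin 2) ℂ) - 1‖ < s) →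
          ∀ m, m ≤ K - n → ∃ u : LSite (F.P K).d → (Matrix (Fin 2) (Fin 2) ℂ)ˣ,
          (∀ x, ((u x : (Matrix (Fin 2) (Fin 2) ℂ)ˣ) : Matrix (Fin 2) (Fin 2) ℂ) ∈ Matrix.specialUnitaryGroup (Fin 2) ℂ) ∧
          Restr129 (F.P K).L m (cubeLamS (F.P K).L a M' ρ' (K - n) m) (1 : LSite (F.P K).d → Fin (F.P K).d → (Matrix (Fin 2) (Fin 2) ℂ)ˣ) u ∧
          ∃ W : LSite (F.P K).d → Fin (F.P K).d → (Matrix (Fin 2) (Fin 2) ℂ)ˣ,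
          mgauge (1 : LSite (F.P K).d → Fin (F.P K).d → (Matrix (Fin 2) (Fin 2) ℂ)ˣ) u W = pull (unitsField (toUField (GaugeField.gaugeAct gJ U))) 0 ∧
          (1 ≤ m → IsLandau138W (F.P K).L m (((F.L : ℝ)⁻¹) ^ (K - n)) (cubeFam false (F.P K).L a M' ρ' (K - n) 0) (cubeLamS (F.P K).L a M' ρ' (K - n) m)
          (1 : LSite (F.P K).d → Fin (F.P K).d → (Matrix (Fin 2) (Fin 2) ℂ)ˣ) W) ∧
          ∃ A : LSite (F.P K).d → Fin (F.P K).d → Matrix (Fin 2) (Fin 2) ℂ, ∀ j, j ≤ m →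
          ∀ b ∈ {b : LSite (F.P K).d × Fin (F.P K).d | SideTouches (cubeFam false (F.P K).L a M' ρ' (K - n) j) b.1 b.2},
          W b.1 b.2 = cfgExp (((F.L : ℝ)⁻¹) ^ (K - n)) A b.1 b.2 ∧ IsSelfAdjoint (A b.1 b.2) ∧
          ‖A b.1 b.2‖ ≤ cstar * (((F.P K).L : ℝ) ^ j * ((F.L : ℝ)⁻¹) ^ (K - n))⁻¹) ∧
        -- `SB9L`: the b9 in-edge of Prop. 3's frame at level `K − n − 1` (lit `SockB9P3` at `M₂(ℂ)`), with its Hölder length `len` per cube family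
        (∀ (F : T3Family) (n K : ℕ), n < K → ∀ (a : LSite (F.P K).d) (ρ' : ℕ), ∃ len : LSite (F.P K).d → ℝ,
          @SockB9P3 (F.P K).d (Matrix (Fin 2) (Fin 2) ℂ) (B10Eq29TubeLine.cstarAlgebraMatrix 2) (F.P K).L B₀ B₀β cB9 β len (((F.L : ℝ)⁻¹) ^ (K - n)) (K - n - 1)
          (cubeFam false (F.P K).L a M' ρ' (K - n)) (cubeLamS (F.P K).L a M' ρ' (K - n)) (cubeLamB (F.P K).L a M' ρ' (K - n))) ∧
        (∀ (F : T3Family) (n K : ℕ), n < K → ∀ (a : LSite (F.P K).d) (ρ' : ℕ),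
          ∃ (g Δ : (LSite (F.P K).d → (Matrix (Fin 2) (Fin 2) ℂ)) →ₗ[ℂ] (LSite (F.P K).d → (Matrix (Fin 2) (Fin 2) ℂ))) (q : (LSite (F.P K).d → (Matrix (Fin 2) (Fin 2) ℂ)) →ₗ[ℂ] (ℕ → LSite (F.P K).d → (Matrix (Fin 2) (Fin 2) ℂ)))
          (qs : (ℕ → LSite (F.P K).d → (Matrix (Fin 2) (Fin 2) ℂ)) →ₗ[ℂ] (LSite (F.P K).d → (Matrix (Fin 2) (Fin 2) ℂ))) (Aw c : (ℕ → LSite (F.P K).d → (Matrix (Fin 2) (Fin 2) ℂ)) →ₗ[ℂ] (ℕ → LSite (F.P K).d → (Matrix (Fin 2) (Fin 2) ℂ)))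
          (H' : XSpace (F.P K).d (K - n) (Matrix (Fin 2) (Fin 2) ℂ) →ₗ[ℂ] (LSite (F.P K).d → (Matrix (Fin 2) (Fin 2) ℂ))),
          (∀ x, ∀ y ∈ (cubeFam false (F.P K).L a M' ρ' (K - n)) 0, (Δ (g x) + qs (Aw (q (g x)))) y = x y) ∧ (∀ f, q (g (g (qs (c (q f))))) = q f) ∧
          (∀ (f : LSite (F.P K).d → (Matrix (Fin 2) (Fin 2) ℂ)), ∀ x ∈ (cubeFam false (F.P K).L a M' ρ' (K - n)) 0, Δ f x = covLap (((F.L : ℝ)⁻¹) ^ (K - n)) (1 : LSite (F.P K).d → Fin (F.P K).d → (Matrix (Fin 2) (Fin 2) ℂ)ˣ) (((cubeFam false (F.P K).L a M' ρ' (K - n)) 0).indicator f) x) ∧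
          (∀ (μ : ℕ → LSite (F.P K).d → (Matrix (Fin 2) (Fin 2) ℂ)), ∀ x ∈ (cubeFam false (F.P K).L a M' ρ' (K - n)) 0, qs μ x = QT (F.P K).L (K - n) (cubeLamS (F.P K).L a M' ρ' (K - n) (K - n)) (1 : LSite (F.P K).d → Fin (F.P K).d → (Matrix (Fin 2) (Fin 2) ℂ)ˣ) μ x) ∧
          (∀ (f : LSite (F.P K).d → (Matrix (Fin 2) (Fin 2) ℂ)) (j : ℕ), j ≤ K - n → ∀ y ∈ (cubeLamS (F.P K).L a M' ρ' (K - n) (K - n)) j, q f j y = QprimeIter (zdBlocking (F.P K).d (F.P K).L) (bgT (F.P K).L (1 : LSite (F.P K).d → Fin (F.P K).d → (Matrix (Fin 2) (Fin 2) ℂ)ˣ)) j f y) ∧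
          (∀ (X : XSpace (F.P K).d (K - n) (Matrix (Fin 2) (Fin 2) ℂ)) (x : LSite (F.P K).d), ‖H' X x‖ ≤ B₀'H * ‖X‖) ∧
          (∀ j, j ≤ K - n → ∀ (X : XSpace (F.P K).d (K - n) (Matrix (Fin 2) (Fin 2) ℂ)), ∀ p ∈ {b : LSite (F.P K).d × Fin (F.P K).d | SideTouches ((cubeFam false (F.P K).L a M' ρ' (K - n)) j) b.1 b.2},
          wt (F.P K).L (((F.L : ℝ)⁻¹) ^ (K - n)) j * ‖covDerivFwd (((F.L : ℝ)⁻¹) ^ (K - n)) (1 : LSite (F.P K).d → Fin (F.P K).d → (Matrix (Fin 2) (Fin 2) ℂ)ˣ) p.2 (H' X) p.1‖ ≤ B₀'H * ‖X‖) ∧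
          (∀ X : XSpace (F.P K).d (K - n) (Matrix (Fin 2) (Fin 2) ℂ), Bd2 (F.P K).L (((F.L : ℝ)⁻¹) ^ (K - n)) (K - n) (cubeFam false (F.P K).L a M' ρ' (K - n)) (covLap (((F.L : ℝ)⁻¹) ^ (K - n)) (1 : LSite (F.P K).d → Fin (F.P K).d → (Matrix (Fin 2) (Fin 2) ℂ)ˣ) (H' X)) (B₂' * ‖X‖)) ∧
          (∀ (X : XSpace (F.P K).d (K - n) (Matrix (Fin 2) (Fin 2) ℂ)) (x : LSite (F.P K).d), x ∉ (cubeFam false (F.P K).L a M' ρ' (K - n)) 0 → H' X x = 0) ∧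
          (∀ X Y : XSpace (F.P K).d (K - n) (Matrix (Fin 2) (Fin 2) ℂ), (∀ p, Y p = -star (X p)) → ∀ x, H' Y x = -star (H' X x)) ∧
          (∀ (Y : XSpace (F.P K).d (K - n) (Matrix (Fin 2) (Fin 2) ℂ)) (j : ℕ) (hj : j ≤ K - n) (y : LSite (F.P K).d), y ∈ (cubeLamS (F.P K).L a M' ρ' (K - n) (K - n)) j →
          QprimeIter (zdBlocking (F.P K).d (F.P K).L) (bgT (F.P K).L (1 : LSite (F.P K).d → Fin (F.P K).d → (Matrix (Fin 2) (Fin 2) ℂ)ˣ)) j (H' Y) y = Y (⟨j, Nat.lt_succ_of_le hj⟩, y)) ∧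
          (∀ (f : LSite (F.P K).d → (Matrix (Fin 2) (Fin 2) ℂ)) (r : ℝ), 0 ≤ r → Bd2 (F.P K).L (((F.L : ℝ)⁻¹) ^ (K - n)) (K - n) (cubeFam false (F.P K).L a M' ρ' (K - n)) f r →
          (∀ x, ‖g f x‖ ≤ BG * r) ∧ ∀ j, j ≤ K - n → ∀ p ∈ {b : LSite (F.P K).d × Fin (F.P K).d | SideTouches ((cubeFam false (F.P K).L a M' ρ' (K - n)) j) b.1 b.2},
          wt (F.P K).L (((F.L : ℝ)⁻¹) ^ (K - n)) j * ‖covDerivFwd (((F.L : ℝ)⁻¹) ^ (K - n)) (1 : LSite (F.P K).d → Fin (F.P K).d → (Matrix (Fin 2) (Fin 2) ℂ)ˣ) p.2 (g f) p.1‖ ≤ BG * r) ∧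
          (∀ (f : LSite (F.P K).d → (Matrix (Fin 2) (Fin 2) ℂ)) (x : LSite (F.P K).d), x ∉ (cubeFam false (F.P K).L a M' ρ' (K - n)) 0 → g f x = 0) ∧
          (∀ f : LSite (F.P K).d → (Matrix (Fin 2) (Fin 2) ℂ), (∀ j, j ≤ K - n → ∀ x ∈ (cubeFam false (F.P K).L a M' ρ' (K - n)) j, IsSelfAdjoint (f x)) → ∀ x, IsSelfAdjoint (g f x)) ∧
          (∀ (f : LSite (F.P K).d → (Matrix (Fin 2) (Fin 2) ℂ)) (r : ℝ), 0 ≤ r → Bd2 (F.P K).L (((F.L : ℝ)⁻¹) ^ (K - n)) (K - n) (cubeFam false (F.P K).L a M' ρ' (K - n)) f r → Bd2 (F.P K).L (((F.L : ℝ)⁻¹) ^ (K - n)) (K - n) (cubeFam false (F.P K).L a M' ρ' (K - n)) (f - g (qs (c (q (g f))))) (BR * r)) ∧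
          (∀ f : LSite (F.P K).d → (Matrix (Fin 2) (Fin 2) ℂ), (∀ j, j ≤ K - n → ∀ x ∈ (cubeFam false (F.P K).L a M' ρ' (K - n)) j, IsSelfAdjoint (f x)) → ∀ j, j ≤ K - n → ∀ x ∈ (cubeFam false (F.P K).L a M' ρ' (K - n)) j, IsSelfAdjoint ((f - g (qs (c (q (g f))))) x)) ∧
          (∀ X : XSpace (F.P K).d (K - n) (Matrix (Fin 2) (Fin 2) ℂ), (∀ p, trCLM (Fin 2) (X p) = 0) → ∀ x, trCLM (Fin 2) (H' X x) = 0) ∧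
          (∀ f : LSite (F.P K).d → (Matrix (Fin 2) (Fin 2) ℂ), (∀ j, j ≤ K - n → ∀ x ∈ (cubeFam false (F.P K).L a M' ρ' (K - n)) j, trCLM (Fin 2) (f x) = 0) → ∀ x, trCLM (Fin 2) (g f x) = 0) ∧
          (∀ f : LSite (F.P K).d → (Matrix (Fin 2) (Fin 2) ℂ), (∀ j, j ≤ K - n → ∀ x ∈ (cubeFam false (F.P K).L a M' ρ' (K - n)) j, trCLM (Fin 2) (f x) = 0) → ∀ j, j ≤ K - n → ∀ x ∈ (cubeFam false (F.P K).L a M' ρ' (K - n)) j, trCLM (Fin 2) ((f - g (qs (c (q (g f))))) x) = 0)) ∧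
        -- `SLetτL` ([4] letters, geometry only) ∕ `H42L` (Prop. 3 (1.42)) ∕ `H59L` ([4] Thm 3.3): ✓p660425's texts, the last two ∀ (gJ, g′)-closed under every member datum
        (∀ (F : T3Family), F.L = L → ∀ (n K : ℕ) (hnK : n < K) (ρ S M ρ' : ℕ), ρ' = ρ + M + L + S → 1 ≤ M → 2 ≤ S →
          ∀ (a₅ Cr ε₀ ε₁ : ℝ), 0 < Cr → 12 * ((ρ : ℝ) + (M : ℝ)) * a₅ ≤ Cr → 0 < ε₁ → 0 < ε₀ → ε₀ ≤ a₅ → Cr * ε₁ ≤ ε₀ →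
          (10 : ℝ) ^ 29 * (L : ℝ) ^ 12 * (1 + B₀ + B₀⁻¹) ^ 2 * ((1 + B₀'H) * (1 + B₂') * (1 + BG) * (1 + BR)) ^ 5 * (1 + cB9⁻¹) *
            ((((ρ + M + L + S : ℕ) : ℝ) + (M' : ℝ) + 1) ^ 3 * ε₀) ≤ 1 →
          2 * ρ + (M' + 1 + 2 * (M + L + S)) ≤ F.L ^ (F.m + n) →
          ∀ (V : GaugeField (F.P n) 0 (Matrix.specialUnitaryGroup (Fin 2) ℂ)), PlaqSmall ε₁ V → ∀ U ∈ regFibrePr F n K hnK.le ε₀ V,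
          ∀ (x₀ : Site (F.P K) 0) (t : ℤ), 0 ≤ t → t ≤ (M' : ℤ) - 1 →
          ∀ (a : LSite (F.P K).d), a = (fun μ => ((iterBlockOf (K - n) x₀ μ).val : ℤ) - t) →
          ∀ (α₁ α₄ cstar : ℝ), α₁ = 198 * (((ρ' : ℝ) + M' + 1) * ε₀) + 27 * (((ρ' : ℝ) + M' + 1) * ε₀) / ((L : ℝ) * B₀) →
          cstar = 5 * (F.P K).d * (F.P K).L * B₀ * (ε₀ + α₁) →
          α₄ = 8 * (300 * (L : ℝ) * ((3 * (M' + ρ') + 1 : ℕ) : ℝ) * (B₀'H + 15 * (L : ℝ) ^ 2 * BG * BR + 3 * BG * BR * B₂')) * (5 * ((3 : ℕ) : ℝ) * L * B₀) * (ε₀ + α₁) →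
          ∀ (gJ : GaugeTransf (F.P K) 0 (Matrix.specialUnitaryGroup (Fin 2) ℂ)),
          InAk (F.P K).L (K - n) (((F.L : ℝ)⁻¹) ^ (K - n)) ε₀ (fun _ => (Set.univ : Set (LSite (F.P K).d))) (pull (unitsField (toUField (GaugeField.gaugeAct gJ U))) 0) →
          (∀ m', m' ≤ K - n → ∀ Λ : ℕ → Set (LSite (F.P K).d), InAx (F.P K).L m' Λ (1 : LSite (F.P K).d → Fin (F.P K).d → (Matrix (Fin 2) (Fin 2) ℂ)ˣ) (pull (unitsField (toUField (GaugeField.gaugeAct gJ U))) 0)) →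
          ∀ (g' : GaugeTransf (F.P K) 0 (Matrix (Fin 2) (Fin 2) ℂ)ˣ) (u : LSite (F.P K).d → (Matrix (Fin 2) (Fin 2) ℂ)ˣ) (V' : LSite (F.P K).d → Fin (F.P K).d → (Matrix (Fin 2) (Fin 2) ℂ)ˣ)
          (A' : LSite (F.P K).d → Fin (F.P K).d → (Matrix (Fin 2) (Fin 2) ℂ)),
          (∀ x, u x ∈ unitaryUnits (Matrix (Fin 2) (Fin 2) ℂ)) → mgauge (1 : LSite (F.P K).d → Fin (F.P K).d → (Matrix (Fin 2) (Fin 2) ℂ)ˣ) u V' = (pull (unitsField (toUField (GaugeField.gaugeAct gJ U))) 0) →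
          Restr129 (F.P K).L (K - n) (Function.update (cubeLamS (F.P K).L a M' ρ' (K - n) (K - n)) (K - n) ∅) (1 : LSite (F.P K).d → Fin (F.P K).d → (Matrix (Fin 2) (Fin 2) ℂ)ˣ) u →
          (IsLandau138W (F.P K).L (K - n) (((F.L : ℝ)⁻¹) ^ (K - n)) ((cubeFam false (F.P K).L a M' ρ' (K - n)) 0) (cubeLamS (F.P K).L a M' ρ' (K - n) (K - n)) (1 : LSite (F.P K).d → Fin (F.P K).d → (Matrix (Fin 2) (Fin 2) ℂ)ˣ) V' ∧
          (∀ c ∈ (cubeLamB (F.P K).L a M' ρ' (K - n) (K - n)) (K - n), ∀ (y : LSite (F.P K).d) (τ : Fin (F.P K).d),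
          InBox (loK (F.P K).L (K - n) c.1) (bondHiK (F.P K).L (K - n) c.1 c.2) y → InBox (loK (F.P K).L (K - n) c.1) (bondHiK (F.P K).L (K - n) c.1 c.2) (y + e τ) →
          V' y τ = gaugeActT g' (unitsField (toUField U)) ⟨cover (F.P K) y, τ⟩)) →
          (∀ y τ, IsSelfAdjoint (A' y τ)) →
          (∀ j, j ≤ K - n → ∀ y τ, SideTouches ((cubeFam false (F.P K).L a M' ρ' (K - n)) j) y τ →
          V' y τ = cfgExp (((F.L : ℝ)⁻¹) ^ (K - n)) A' y τ ∧ ‖A' y τ‖ ≤ (2 * ((F.P K).L * cstar) + 8 * α₄) * (((F.P K).L : ℝ) ^ j * (((F.L : ℝ)⁻¹) ^ (K - n)))⁻¹) →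
          (∀ y τ, (∀ j, j ≤ K - n → ¬ SideTouches ((cubeFam false (F.P K).L a M' ρ' (K - n)) j) y τ) → A' y τ = 0) →
          ∀ j, j ≤ K - n → ∀ c ∈ (cubeLamB (F.P K).L a M' ρ' (K - n) (K - n)) j, ‖logCovIter (F.P K).L (1 : LSite (F.P K).d → Fin (F.P K).d → (Matrix (Fin 2) (Fin 2) ℂ)ˣ) (iEta (((F.L : ℝ)⁻¹) ^ (K - n)) A') j c.1 c.2‖ < 2 * (F.P K).d * (F.P K).L * α₁) ∧
        (∀ (F : T3Family), F.L = L → ∀ (n K : ℕ) (hnK : n < K) (ρ S M ρ' : ℕ), ρ' = ρ + M + L + S → 1 ≤ M → 2 ≤ S →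
          ∀ (a₅ Cr ε₀ ε₁ : ℝ), 0 < Cr → 12 * ((ρ : ℝ) + (M : ℝ)) * a₅ ≤ Cr → 0 < ε₁ → 0 < ε₀ → ε₀ ≤ a₅ → Cr * ε₁ ≤ ε₀ →
          (10 : ℝ) ^ 29 * (L : ℝ) ^ 12 * (1 + B₀ + B₀⁻¹) ^ 2 * ((1 + B₀'H) * (1 + B₂') * (1 + BG) * (1 + BR)) ^ 5 * (1 + cB9⁻¹) *
            ((((ρ + M + L + S : ℕ) : ℝ) + (M' : ℝ) + 1) ^ 3 * ε₀) ≤ 1 →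
          2 * ρ + (M' + 1 + 2 * (M + L + S)) ≤ F.L ^ (F.m + n) →
          ∀ (V : GaugeField (F.P n) 0 (Matrix.specialUnitaryGroup (Fin 2) ℂ)), PlaqSmall ε₁ V → ∀ U ∈ regFibrePr F n K hnK.le ε₀ V,
          ∀ (x₀ : Site (F.P K) 0) (t : ℤ), 0 ≤ t → t ≤ (M' : ℤ) - 1 →
          ∀ (a : LSite (F.P K).d), a = (fun μ => ((iterBlockOf (K - n) x₀ μ).val : ℤ) - t) →
          ∀ (α₁ α₄ cstar : ℝ), α₁ = 198 * (((ρ' : ℝ) + M' + 1) * ε₀) + 27 * (((ρ' : ℝ) + M' + 1) * ε₀) / ((L : ℝ) * B₀) →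
          cstar = 5 * (F.P K).d * (F.P K).L * B₀ * (ε₀ + α₁) →
          α₄ = 8 * (300 * (L : ℝ) * ((3 * (M' + ρ') + 1 : ℕ) : ℝ) * (B₀'H + 15 * (L : ℝ) ^ 2 * BG * BR + 3 * BG * BR * B₂')) * (5 * ((3 : ℕ) : ℝ) * L * B₀) * (ε₀ + α₁) →
          ∀ (gJ : GaugeTransf (F.P K) 0 (Matrix.specialUnitaryGroup (Fin 2) ℂ)),
          InAk (F.P K).L (K - n) (((F.L : ℝ)⁻¹) ^ (K - n)) ε₀ (fun _ => (Set.univ : Set (LSite (F.P K).d))) (pull (unitsField (toUField (GaugeField.gaugeAct gJ U))) 0) →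
          (∀ m', m' ≤ K - n → ∀ Λ : ℕ → Set (LSite (F.P K).d), InAx (F.P K).L m' Λ (1 : LSite (F.P K).d → Fin (F.P K).d → (Matrix (Fin 2) (Fin 2) ℂ)ˣ) (pull (unitsField (toUField (GaugeField.gaugeAct gJ U))) 0)) →
          ∀ (g' : GaugeTransf (F.P K) 0 (Matrix (Fin 2) (Fin 2) ℂ)ˣ) (u : LSite (F.P K).d → (Matrix (Fin 2) (Fin 2) ℂ)ˣ) (V' : LSite (F.P K).d → Fin (F.P K).d → (Matrix (Fin 2) (Fin 2) ℂ)ˣ)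
          (A' : LSite (F.P K).d → Fin (F.P K).d → (Matrix (Fin 2) (Fin 2) ℂ)),
          (∀ x, u x ∈ unitaryUnits (Matrix (Fin 2) (Fin 2) ℂ)) → mgauge (1 : LSite (F.P K).d → Fin (F.P K).d → (Matrix (Fin 2) (Fin 2) ℂ)ˣ) u V' = (pull (unitsField (toUField (GaugeField.gaugeAct gJ U))) 0) →
          Restr129 (F.P K).L (K - n) (Function.update (cubeLamS (F.P K).L a M' ρ' (K - n) (K - n)) (K - n) ∅) (1 : LSite (F.P K).d → Fin (F.P K).d → (Matrix (Fin 2) (Fin 2) ℂ)ˣ) u →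
          (IsLandau138W (F.P K).L (K - n) (((F.L : ℝ)⁻¹) ^ (K - n)) ((cubeFam false (F.P K).L a M' ρ' (K - n)) 0) (cubeLamS (F.P K).L a M' ρ' (K - n) (K - n)) (1 : LSite (F.P K).d → Fin (F.P K).d → (Matrix (Fin 2) (Fin 2) ℂ)ˣ) V' ∧
          (∀ c ∈ (cubeLamB (F.P K).L a M' ρ' (K - n) (K - n)) (K - n), ∀ (y : LSite (F.P K).d) (τ : Fin (F.P K).d),
          InBox (loK (F.P K).L (K - n) c.1) (bondHiK (F.P K).L (K - n) c.1 c.2) y → InBox (loK (F.P K).L (K - n) c.1) (bondHiK (F.P K).L (K - n) c.1 c.2) (y + e τ) →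
          V' y τ = gaugeActT g' (unitsField (toUField U)) ⟨cover (F.P K) y, τ⟩)) →
          (∀ y τ, IsSelfAdjoint (A' y τ)) →
          (∀ j, j ≤ K - n → ∀ y τ, SideTouches ((cubeFam false (F.P K).L a M' ρ' (K - n)) j) y τ →
          V' y τ = cfgExp (((F.L : ℝ)⁻¹) ^ (K - n)) A' y τ ∧ ‖A' y τ‖ ≤ (2 * ((F.P K).L * cstar) + 8 * α₄) * (((F.P K).L : ℝ) ^ j * (((F.L : ℝ)⁻¹) ^ (K - n)))⁻¹) →
          (∀ y τ, (∀ j, j ≤ K - n → ¬ SideTouches ((cubeFam false (F.P K).L a M' ρ' (K - n)) j) y τ) → A' y τ = 0) →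
          msup (F.P K).L (K - n) (((F.L : ℝ)⁻¹) ^ (K - n)) (-(1 : ℝ)) (fun j (b : LSite (F.P K).d × Fin (F.P K).d) => SideTouches ((cubeFam false (F.P K).L a M' ρ' (K - n)) j) b.1 b.2) (fun b => A' b.1 b.2)
          ≤ B₀ * (bondNorm (F.P K).L (K - n) (((F.L : ℝ)⁻¹) ^ (K - n)) (-(3 : ℝ)) (cubeFam false (F.P K).L a M' ρ' (K - n)) (fun x μ => Jcur (((F.L : ℝ)⁻¹) ^ (K - n)) (1 : LSite (F.P K).d → Fin (F.P K).d → (Matrix (Fin 2) (Fin 2) ℂ)ˣ) A' μ x)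
          + wsup 1 (fun p : {p : ℕ × (LSite (F.P K).d × Fin (F.P K).d) // p.1 ≤ K - n ∧ p.2 ∈ (cubeLamB (F.P K).L a M' ρ' (K - n) (K - n)) p.1} =>
          linCovIter (F.P K).L (1 : LSite (F.P K).d → Fin (F.P K).d → (Matrix (Fin 2) (Fin 2) ℂ)ˣ) (iEta (((F.L : ℝ)⁻¹) ^ (K - n)) A') p.1.1 p.1.2.1 p.1.2.2)) ∧
          msup (F.P K).L (K - n) (((F.L : ℝ)⁻¹) ^ (K - n)) (-(2 : ℝ)) (fun j (t : Fin (F.P K).d × Fin (F.P K).d × LSite (F.P K).d) => SideTouches ((cubeFam false (F.P K).L a M' ρ' (K - n)) j) t.2.2 t.2.1)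
          (fun t => covDerivFwd (((F.L : ℝ)⁻¹) ^ (K - n)) (1 : LSite (F.P K).d → Fin (F.P K).d → (Matrix (Fin 2) (Fin 2) ℂ)ˣ) t.1 (fun z => A' z t.2.1) t.2.2)
          ≤ B₀ * (bondNorm (F.P K).L (K - n) (((F.L : ℝ)⁻¹) ^ (K - n)) (-(3 : ℝ)) (cubeFam false (F.P K).L a M' ρ' (K - n)) (fun x μ => Jcur (((F.L : ℝ)⁻¹) ^ (K - n)) (1 : LSite (F.P K).d → Fin (F.P K).d → (Matrix (Fin 2) (Fin 2) ℂ)ˣ) A' μ x)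
          + wsup 1 (fun p : {p : ℕ × (LSite (F.P K).d × Fin (F.P K).d) // p.1 ≤ K - n ∧ p.2 ∈ (cubeLamB (F.P K).L a M' ρ' (K - n) (K - n)) p.1} =>
          linCovIter (F.P K).L (1 : LSite (F.P K).d → Fin (F.P K).d → (Matrix (Fin 2) (Fin 2) ℂ)ˣ) (iEta (((F.L : ℝ)⁻¹) ^ (K - n)) A') p.1.1 p.1.2.1 p.1.2.2)))) :
    ∀ L : ℕ, Odd L → 1 < L → ∃ (B₀ : ℝ) (_ : 0 ≤ B₀) (Cw : ℝ) (_ : 0 < Cw) (Mₚ : ℕ),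
      ∀ (ρ S M : ℕ) (hM : 1 ≤ M), Mₚ ≤ M → 2 ≤ S → ∀ (a Cr : ℝ), 0 < Cr → 12 * ((ρ : ℝ) + (M : ℝ)) * a ≤ Cr →
      ∀ (ε₀ ε₁ : ℝ), 0 < ε₁ → 0 < ε₀ → ε₀ ≤ a → Cr * ε₁ ≤ ε₀ →
      Cw * ((((ρ + M + L + S : ℕ) : ℝ) + (M' : ℝ) + 1) ^ 3 * ε₀) ≤ 1 →
      ∀ (Bsz : ℝ), (2985 * (L : ℝ) * B₀ + 405) * ((((ρ + M + L + S : ℕ) : ℝ) + (M' : ℝ) + 1)) ≤ Bsz →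
      ∀ F : T3Family, F.L = L → ∀ (n K : ℕ) (hnK : n < K), 2 ≤ K - n → 2 * ρ + (M' + 1 + 2 * (M + L + S)) ≤ F.L ^ (F.m + n) →
        ∀ V : GaugeField (F.P n) 0 (Matrix.specialUnitaryGroup (Fin 2) ℂ), PlaqSmall ε₁ V →
          ∀ U ∈ regFibrePr F n K hnK.le ε₀ V, ∀ x₀ : Site (F.P K) 0,
              ∃ (t : ℤ) (_ : 0 ≤ t) (_ : t ≤ (M' : ℤ) - 1)
                (gJ : GaugeTransf (F.P K) 0 (Matrix.specialUnitaryGroup (Fin 2) ℂ))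
                (u₁ : LSite (F.P K).d → (Matrix (Fin 2) (Fin 2) ℂ)ˣ)
                (W : LSite (F.P K).d → Fin (F.P K).d → (Matrix (Fin 2) (Fin 2) ℂ)ˣ)
                (A : LSite (F.P K).d → Fin (F.P K).d → Matrix (Fin 2) (Fin 2) ℂ)
                (c₁ c' : ℝ)
                (κf : (Site (F.P K) 0 → Matrix (Fin 2) (Fin 2) ℂ) → (i : ℕ) → GaugeTransf (F.P K) i (Matrix (Fin 2) (Fin 2) ℂ)ˣ)
                (lam : LSite (F.P K).d → Matrix (Fin 2) (Fin 2) ℂ)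
                (α₄ cA : ℝ),
                -- hu₁SU
                (∀ z, ((u₁ z : (Matrix (Fin 2) (Fin 2) ℂ)ˣ) : Matrix (Fin 2) (Fin 2) ℂ) ∈ Matrix.specialUnitaryGroup (Fin 2) ℂ) ∧
                -- hW
                (mgauge (1 : LSite (F.P K).d → Fin (F.P K).d → (Matrix (Fin 2) (Fin 2) ℂ)ˣ) u₁ W = pull (unitsField (toUField (GaugeField.gaugeAct gJ U))) 0) ∧
                -- hchart₀
                (∀ b ∈ {b : LSite (F.P K).d × Fin (F.P K).d | SideTouches (cubeFam false (F.P K).L (fun μ => ((iterBlockOf (K - n) x₀ μ).val : ℤ) - t) M' (ρ + M + L + S) (K - n) 0) b.1 b.2},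
      W b.1 b.2 = cfgExp (((F.L : ℝ)⁻¹) ^ (K - n)) A b.1 b.2) ∧
                -- hc'
                (0 ≤ c') ∧
                -- hbudget
                (8 * 3800 * ((((F.P K).d + 2) * (F.P K).L : ℕ) : ℝ) ^ 2 * c' ≤ 1) ∧
                -- hc₁
                (Real.exp c₁ - 1 ≤ ((F.L : ℝ)⁻¹) ^ (K - n) * c') ∧
                -- hchartTop
                (∀ z ∈ cube (F.P K).L (fun μ => ((iterBlockOf (K - n) x₀ μ).val : ℤ) - t) M' (ρ + M + L + S) (K - n) (K - n), ∀ ν : Fin (F.P K).d,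
      W z ν = cfgExp (((F.L : ℝ)⁻¹) ^ (K - n)) A z ν ∧ ((F.L : ℝ)⁻¹) ^ (K - n) * ‖A z ν‖ ≤ c₁) ∧
                -- hκfs
                (∀ (m : Site (F.P K) 0 → Matrix (Fin 2) (Fin 2) ℂ) (i : ℕ) (y : Site (F.P K) (i + 1)),
      κf m (i + 1) y = (vframeU (gaugeActT (κf m i) (dbarIterU i (gaugeActT
        (fun s => (u₁ (lift (F.P K) x₀ + rel x₀ s))⁻¹ * Unitary.toUnits (suIncl (gJ s)) : GaugeTransf (F.P K) 0 (Matrix (Fin 2) (Fin 2) ℂ)ˣ)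
        (unitsField (toUField U))))) y)⁻¹ * κf m i (emb y) *
        vframeU (dbarIterU i (gaugeActT
          (fun s => (u₁ (lift (F.P K) x₀ + rel x₀ s))⁻¹ * Unitary.toUnits (suIncl (gJ s)) : GaugeTransf (F.P K) 0 (Matrix (Fin 2) (Fin 2) ℂ)ˣ)
          (unitsField (toUField U)))) y) ∧
                -- hκf0
                (∀ (m : Site (F.P K) 0 → Matrix (Fin 2) (Fin 2) ℂ) (x : Site (F.P K) 0), ((κf m 0 x : (Matrix (Fin 2) (Fin 2) ℂ)ˣ) : Matrix (Fin 2) (Fin 2) ℂ) = exp (m x)) ∧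
                -- hα0
                (0 ≤ α₄) ∧
                -- hα
                (α₄ ≤ 1 / 70) ∧
                -- hcA0
                (0 ≤ cA) ∧
                -- hcA
                (cA ≤ 1 / 12) ∧
                -- hsa
                (∀ x, IsSelfAdjoint (lam x)) ∧
                -- htr
                (∀ x, (lam x).trace = 0) ∧
                -- hsupp
                (∀ x, x ∉ cubeFam false (F.P K).L (fun μ => ((iterBlockOf (K - n) x₀ μ).val : ℤ) - t) M' (ρ + M + L + S) (K - n) 0 → lam x = 0) ∧
                -- h108₀
                (∀ b ∈ {b : LSite (F.P K).d × Fin (F.P K).d | SideTouches (cubeFam false (F.P K).L (fun μ => ((iterBlockOf (K - n) x₀ μ).val : ℤ) - t) M' (ρ + M + L + S) (K - n) 0) b.1 b.2},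
      ‖lam b.1‖ ≤ α₄ ∧ wt (F.P K).L (((F.L : ℝ)⁻¹) ^ (K - n)) 0 *
        ‖covDerivFwd (((F.L : ℝ)⁻¹) ^ (K - n)) (1 : LSite (F.P K).d → Fin (F.P K).d → (Matrix (Fin 2) (Fin 2) ℂ)ˣ) b.2 lam b.1‖ ≤ α₄) ∧
                -- hmult
                (∃ μ : ℕ → LSite (F.P K).d → Matrix (Fin 2) (Fin 2) ℂ, ∀ x ∈ cubeFam false (F.P K).L (fun μ => ((iterBlockOf (K - n) x₀ μ).val : ℤ) - t) M' (ρ + M + L + S) (K - n) 0,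
      covLap (((F.L : ℝ)⁻¹) ^ (K - n)) (1 : LSite (F.P K).d → Fin (F.P K).d → (Matrix (Fin 2) (Fin 2) ℂ)ˣ)
        ((cubeFam false (F.P K).L (fun μ => ((iterBlockOf (K - n) x₀ μ).val : ℤ) - t) M' (ρ + M + L + S) (K - n) 0).indicator fun y =>
          covDivB (((F.L : ℝ)⁻¹) ^ (K - n)) (1 : LSite (F.P K).d → Fin (F.P K).d → (Matrix (Fin 2) (Fin 2) ℂ)ˣ) A y +
          covLap (((F.L : ℝ)⁻¹) ^ (K - n)) (1 : LSite (F.P K).d → Fin (F.P K).d → (Matrix (Fin 2) (Fin 2) ℂ)ˣ) lam y +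
          ((conjR (gaugeExp lam y)⁻¹ (covDivB (((F.L : ℝ)⁻¹) ^ (K - n)) (1 : LSite (F.P K).d → Fin (F.P K).d → (Matrix (Fin 2) (Fin 2) ℂ)ˣ) A y) -
              covDivB (((F.L : ℝ)⁻¹) ^ (K - n)) (1 : LSite (F.P K).d → Fin (F.P K).d → (Matrix (Fin 2) (Fin 2) ℂ)ˣ) A y) +
            (gAd (covLap (((F.L : ℝ)⁻¹) ^ (K - n)) (1 : LSite (F.P K).d → Fin (F.P K).d → (Matrix (Fin 2) (Fin 2) ℂ)ˣ) lam y) (lam y) -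
              covLap (((F.L : ℝ)⁻¹) ^ (K - n)) (1 : LSite (F.P K).d → Fin (F.P K).d → (Matrix (Fin 2) (Fin 2) ℂ)ˣ) lam y) +
            ∑ μ, frakF3 (((F.L : ℝ)⁻¹) ^ (K - n)) (1 : LSite (F.P K).d → Fin (F.P K).d → (Matrix (Fin 2) (Fin 2) ℂ)ˣ) lam A y μ)) x =
        QT (F.P K).L (K - n) (cubeLamS (F.P K).L (fun μ => ((iterBlockOf (K - n) x₀ μ).val : ℤ) - t) M' (ρ + M + L + S) (K - n) (K - n)) (1 : LSite (F.P K).d → Fin (F.P K).d → (Matrix (Fin 2) (Fin 2) ℂ)ˣ) μ x) ∧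
                -- htopId
                (∀ yc ∈ cubeLamS (F.P K).L (fun μ => ((iterBlockOf (K - n) x₀ μ).val : ℤ) - t) M' (ρ + M + L + S) (K - n) (K - n) (K - n),
      κf (((-I) • lam) ∘ fun s : Site (F.P K) 0 => lift (F.P K) x₀ + rel x₀ s) (K - n) (coverAt (F.P K) (K - n) yc) =
        axialT (dbarIterU (K - n) (gaugeActT
          (fun s => (u₁ (lift (F.P K) x₀ + rel x₀ s))⁻¹ * Unitary.toUnits (suIncl (gJ s)) : GaugeTransf (F.P K) 0 (Matrix (Fin 2) (Fin 2) ℂ)ˣ)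
          (unitsField (toUField U)))) (iterBlockOf (K - n) x₀) (coverAt (F.P K) (K - n) yc)) ∧
                -- hA0
                (∀ x ∈ cubeFam false (F.P K).L (fun μ => ((iterBlockOf (K - n) x₀ μ).val : ℤ) - t) M' (ρ + M + L + S) (K - n) 0, ∀ μ : Fin (F.P K).d,
      wt (F.P K).L (((F.L : ℝ)⁻¹) ^ (K - n)) 0 * ‖A x μ‖ ≤ cA ∧
        wt (F.P K).L (((F.L : ℝ)⁻¹) ^ (K - n)) 0 *
          ‖conjR ((1 : LSite (F.P K).d → Fin (F.P K).d → (Matrix (Fin 2) (Fin 2) ℂ)ˣ) (x - e μ) μ)⁻¹ (A (x - e μ) μ)‖ ≤ cA) ∧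
                -- hX1
                (∀ j, j ≤ K - n → ∀ z ∈ cube (F.P K).L (fun μ => ((iterBlockOf (K - n) x₀ μ).val : ℤ) - t) M' (ρ + M + L + S) (K - n) j, ∀ ν' : Fin (F.P K).d,
      (F.L : ℝ) ^ j * ((F.L : ℝ)⁻¹) ^ (K - n) *
        ‖logCfg (((F.L : ℝ)⁻¹) ^ (K - n)) (mgauge (1 : LSite (F.P K).d → Fin (F.P K).d → (Matrix (Fin 2) (Fin 2) ℂ)ˣ) (gaugeExp lam)⁻¹
          (cfgExp (((F.L : ℝ)⁻¹) ^ (K - n)) A)) z ν'‖ ≤ Bsz * ε₀) ∧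
                -- hX2
                (∀ j, j ≤ K - n → ∀ z ∈ cube (F.P K).L (fun μ => ((iterBlockOf (K - n) x₀ μ).val : ℤ) - t) M' (ρ + M + L + S) (K - n) j, ∀ ν' μ' : Fin (F.P K).d,
      z + e μ' ∈ cube (F.P K).L (fun μ => ((iterBlockOf (K - n) x₀ μ).val : ℤ) - t) M' (ρ + M + L + S) (K - n) 0 →
      ((F.L : ℝ) ^ j * ((F.L : ℝ)⁻¹) ^ (K - n)) ^ 2 * (F.L : ℝ) ^ (K - n) *
        ‖logCfg (((F.L : ℝ)⁻¹) ^ (K - n)) (mgauge (1 : LSite (F.P K).d → Fin (F.P K).d → (Matrix (Fin 2) (Fin 2) ℂ)ˣ) (gaugeExp lam)⁻¹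
            (cfgExp (((F.L : ℝ)⁻¹) ^ (K - n)) A)) (z + e μ') ν' -
          logCfg (((F.L : ℝ)⁻¹) ^ (K - n)) (mgauge (1 : LSite (F.P K).d → Fin (F.P K).d → (Matrix (Fin 2) (Fin 2) ℂ)ˣ) (gaugeExp lam)⁻¹
            (cfgExp (((F.L : ℝ)⁻¹) ^ (K - n)) A)) z ν'‖ ≤ Bsz * ε₀) := by
  intro L hodd hL
  obtain ⟨B₀, B₀'H, B₂', BG, BR, cB9, B₀β, β, hB₀, hB₀'H, hB₂', hBG, hBR, hcB9, hT4, hSB9, hSLet, hH42, hH59⟩ := hSockets₂ L hodd hL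
  refine ⟨B₀, hB₀.le, (10 : ℝ) ^ 29 * (L : ℝ) ^ 12 * (1 + B₀ + B₀⁻¹) ^ 2 * ((1 + B₀'H) * (1 + B₂') * (1 + BG) * (1 + BR)) ^ 5 * (1 + cB9⁻¹), by positivity, 1,
    fun ρ S M hM hMₚ hS a₅ Cr hCr h12 ε₀ ε₁ hε₁ hε₀ hε₀a hCrε hw Bsz hBsz F hF n K hnK h2 hroom V hV U hU x₀ => ?_⟩
  classical
  have hL3 : 3 ≤ L := by obtain ⟨r, hr⟩ := hodd; omega
  have hd3 : (F.P K).d = 3 := T3Family.P_d F K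
  have hLF : (F.P K).L = F.L := rfl
  have hM'z : (0 : ℤ) ≤ (M' : ℤ) - 1 := by linarith only [show (1 : ℤ) ≤ (M' : ℤ) from by exact_mod_cast hM']
  have hL2P : 2 ≤ (F.P K).L := by rw [hLF, hF]; omega
  have hLr : ((F.P K).L : ℝ) = (L : ℝ) := by rw [hLF, hF]
  have hLpos : (0 : ℝ) < ((F.P K).L : ℝ) := by rw [hLr]; exact_mod_cast (show 0 < L by omega)
  have hw' := hw
  rw [← hLr] at hw'
  obtain ⟨m₀, α₀, α₁, a₆₆, cstar, B₀', α₄, C₂, cB, cA, cDA, c', σ, δ, ω, Cb, Cl, τ₀, e0, eα₀, ea, e1, ec, eB, e4, eC, ecB, ecA, ecDA, ecp, eσ, hδ, hω, hτ₀,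
    ⟨-, -, hα₁, -, hsα₁, ha66lo, hB₀', -, hα₄, -, -, -, -, -, hcA0, -, -, -, -⟩,
    ⟨-, hs₂, ha4, h2s, hα3, hα4, h16, hd5, hsmallP, hc₃P, hside, h50, hC₂, h61⟩,
    ⟨hα₀9, hcs9, hside₀, h61₀, hsmall₁, hcBlo, hcAlo, hcDAlo, hsmall, hc₃, hsc, hα₃', hs₁, hs₂', hs₃, hs₄, hs₅, hs₆, hs₇, hprod8, hcA13, hCblo, hCb₀, hCllo, hCl₀, hCbρ, hClB⟩,
    ⟨hα70, hcA12, -, -, -, -, hs6, -, hσ, hLa2, -, hbudgetσ, hm, hr⟩, hwin⟩ :=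
    exists_topCall_constants_of_rhoWindow₃ (F.P K).d (F.P K).L hd3 hL2P hB₀ hB₀'H hB₂' hBG hBR hcB9 M' (ρ + M + L + S) hε₀ hw'
  subst α₀
  have hM'r : (1 : ℝ) ≤ (M' : ℝ) := by exact_mod_cast hM'
  have hρ'0 : (0 : ℝ) ≤ ((ρ + M + L + S : ℕ) : ℝ) := Nat.cast_nonneg _
  have hX1 : (1 : ℝ) ≤ ((((ρ + M + L + S : ℕ) : ℝ)) + (M' : ℝ) + 1) := by linarith only [hρ'0, hM'r]
  have hsdef : a₆₆ = (198 + 12 * (((M' : ℝ) - 1) + 4 * (ρ + M + L + S : ℕ))) * ε₀ := by rw [ea]; ring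
  have hs0 : 0 ≤ a₆₆ := by
    have : 0 ≤ 198 * ε₀ + 12 * ((M' : ℝ) - 1 + 4 * (ρ + M + L + S : ℕ)) * ε₀ := by
      have h1 : (0 : ℝ) ≤ (M' : ℝ) - 1 + 4 * (ρ + M + L + S : ℕ) := by linarith only [hρ'0, hM'r]
      have h2 : (0 : ℝ) ≤ ((M' : ℝ) - 1 + 4 * (ρ + M + L + S : ℕ)) * ε₀ := mul_nonneg h1 hε₀.le
      linarith only [h2, hε₀.le]
    linarith only [this, ha66lo]
  have hs1 : 2 * a₆₆ ≤ 1 := by linarith only [ha4]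
  have hε : 10 ^ 7 * (F.L : ℝ) ^ 3 * ε₀ ≤ 1 := by
    rw [hF]
    have hL1 : (1 : ℝ) ≤ (L : ℝ) := by exact_mod_cast (show 1 ≤ L by omega)
    have hA : (1 : ℝ) ≤ (1 + B₀ + B₀⁻¹) ^ 2 :=
      one_le_pow₀ (by have := (inv_pos.2 hB₀).le; linarith only [this, hB₀.le])
    have hB : (1 : ℝ) ≤ ((1 + B₀'H) * (1 + B₂') * (1 + BG) * (1 + BR)) ^ 5 := by
      refine one_le_pow₀ ?_
      have a1 : (1 : ℝ) ≤ 1 + B₀'H := by linarith only [hB₀'H.le]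
      have a2 : (1 : ℝ) ≤ 1 + B₂' := by linarith only [hB₂']
      have a3 : (1 : ℝ) ≤ 1 + BG := by linarith only [hBG]
      have a4 : (1 : ℝ) ≤ 1 + BR := by linarith only [hBR]
      exact one_le_mul_of_one_le_of_one_le (one_le_mul_of_one_le_of_one_le (one_le_mul_of_one_le_of_one_le a1 a2) a3) a4
    have hC : (1 : ℝ) ≤ 1 + cB9⁻¹ := by have := (inv_pos.2 hcB9).le; linarith only [this]
    have hX3 : (1 : ℝ) ≤ ((((ρ + M + L + S : ℕ) : ℝ)) + (M' : ℝ) + 1) ^ 3 := one_le_pow₀ hX1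
    have h10 : (10 : ℝ) ^ 7 ≤ 10 ^ 29 := by norm_num
    have hL312 : (L : ℝ) ^ 3 ≤ (L : ℝ) ^ 12 := pow_le_pow_right₀ hL1 (by norm_num)
    calc 10 ^ 7 * (L : ℝ) ^ 3 * ε₀ = 10 ^ 7 * (L : ℝ) ^ 3 * 1 * 1 * 1 * (1 * ε₀) := by ring
      _ ≤ 10 ^ 29 * (L : ℝ) ^ 12 * (1 + B₀ + B₀⁻¹) ^ 2 * ((1 + B₀'H) * (1 + B₂') * (1 + BG) * (1 + BR)) ^ 5 * (1 + cB9⁻¹) *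
          (((((ρ + M + L + S : ℕ) : ℝ)) + (M' : ℝ) + 1) ^ 3 * ε₀) := by gcongr
      _ ≤ 1 := hw
  have hL0 : (L : ℝ) ≠ 0 := by exact_mod_cast (show L ≠ 0 by omega)
  have hB0 : B₀ ≠ 0 := hB₀.ne'
  have ecs : cstar = 15 * (L : ℝ) * B₀ * ε₀ + 2970 * (L : ℝ) * B₀ * (((((ρ + M + L + S : ℕ) : ℝ)) + (M' : ℝ) + 1) * ε₀) + 405 * (((((ρ + M + L + S : ℕ) : ℝ)) + (M' : ℝ) + 1) * ε₀) := by
    rw [ec, e1, hd3, hLr]; push_cast; field_simp; ring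
  have hcsB : cstar ≤ Bsz * ε₀ := by
    have h1 : 15 * (L : ℝ) * B₀ * ε₀ ≤ 15 * (L : ℝ) * B₀ * (((((ρ + M + L + S : ℕ) : ℝ)) + (M' : ℝ) + 1) * ε₀) :=
      mul_le_mul_of_nonneg_left (le_mul_of_one_le_left hε₀.le hX1) (by positivity)
    have h2 : (2985 * (L : ℝ) * B₀ + 405) * ((((ρ + M + L + S : ℕ) : ℝ)) + (M' : ℝ) + 1) * ε₀ ≤ Bsz * ε₀ := mul_le_mul_of_nonneg_right hBsz hε₀.le
    calc cstar = 15 * (L : ℝ) * B₀ * ε₀ + 2970 * (L : ℝ) * B₀ * (((((ρ + M + L + S : ℕ) : ℝ)) + (M' : ℝ) + 1) * ε₀) + 405 * (((((ρ + M + L + S : ℕ) : ℝ)) + (M' : ℝ) + 1) * ε₀) := ecs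
      _ ≤ 15 * (L : ℝ) * B₀ * (((((ρ + M + L + S : ℕ) : ℝ)) + (M' : ℝ) + 1) * ε₀) + 2970 * (L : ℝ) * B₀ * (((((ρ + M + L + S : ℕ) : ℝ)) + (M' : ℝ) + 1) * ε₀) + 405 * (((((ρ + M + L + S : ℕ) : ℝ)) + (M' : ℝ) + 1) * ε₀) := by linarith only [h1]
      _ = (2985 * (L : ℝ) * B₀ + 405) * ((((ρ + M + L + S : ℕ) : ℝ)) + (M' : ℝ) + 1) * ε₀ := by ring
      _ ≤ Bsz * ε₀ := h2
  have h4s : 4 * a₆₆ ≤ cstar := by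
    have hpos : (0 : ℝ) ≤ 15 * (L : ℝ) * B₀ * ε₀ + 2970 * (L : ℝ) * B₀ * (((((ρ + M + L + S : ℕ) : ℝ)) + (M' : ℝ) + 1) * ε₀) := by positivity
    have key : 4 * a₆₆ ≤ 405 * (((((ρ + M + L + S : ℕ) : ℝ)) + (M' : ℝ) + 1) * ε₀) := by
      rw [ea]
      have hM'ε : ε₀ ≤ (M' : ℝ) * ε₀ := le_mul_of_one_le_left hε₀.le hM'r
      have hρε : (0 : ℝ) ≤ ((ρ + M + L + S : ℕ) : ℝ) * ε₀ := mul_nonneg hρ'0 hε₀.le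
      have e : 405 * (((((ρ + M + L + S : ℕ) : ℝ)) + (M' : ℝ) + 1) * ε₀) - 4 * (198 * ε₀ + 12 * ((M' : ℝ) - 1 + 4 * (ρ + M + L + S : ℕ)) * ε₀)
          = 213 * (((ρ + M + L + S : ℕ) : ℝ) * ε₀) + 357 * ((M' : ℝ) * ε₀) - 339 * ε₀ := by ring
      linarith only [e, hM'ε, hρε, hε₀.le]
    linarith only [key, hpos, ecs]
  have hα₁def : α₁ = 198 * (((((ρ + M + L + S : ℕ) : ℝ)) + (M' : ℝ) + 1) * ε₀) + 27 * (((((ρ + M + L + S : ℕ) : ℝ)) + (M' : ℝ) + 1) * ε₀) / ((L : ℝ) * B₀) := by rw [e1, hLr]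
  have hcdef : cstar = 5 * (F.P K).d * (F.P K).L * B₀ * (ε₀ + α₁) := ec
  have hα₄def : α₄ = 8 * (300 * (L : ℝ) * ((3 * (M' + (ρ + M + L + S)) + 1 : ℕ) : ℝ) * (B₀'H + 15 * (L : ℝ) ^ 2 * BG * BR + 3 * BG * BR * B₂')) *
      (5 * ((3 : ℕ) : ℝ) * L * B₀) * (ε₀ + α₁) := by rw [e4, eB, e0, hd3, hLr]
  have hm₀ : (F.P K).d * (M' + (ρ + M + L + S)) ≤ m₀ := by rw [e0, hd3]; omega
  have hcB2 : cstar = 5 * ((F.P K).d : ℝ) * (F.P K).L * B₀ * (ε₀ + α₁) := ec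
  have hα₄B2 : α₄ = 8 * B₀' * (5 * ((F.P K).d : ℝ) * (F.P K).L * B₀) * (ε₀ + α₁) := e4
  obtain ⟨len, hSB9m⟩ := hSB9 F n K hnK (fun μ => ((iterBlockOf (K - n) x₀ μ).val : ℤ) - 0) (ρ + M + L + S)
  exact siteRows_of_sockets F L hF hnK h2 ρ S M M' rfl hε₀ hε hsdef hs6 hroom V U hU x₀ le_rfl hM'z rfl
    hα₁ hB₀ hB₀' hB₀'H hB₂' hBG hBR hsα₁ hcB2 hα₄B2 hs₂ hside₀ hC₂ h61₀ hsmall₁ hα3 hα4 h16 hd5 hsmallP hc₃P hside h50 h61 hcBlo hcAlo hcDAlo hsmall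
    hc₃ hsc hα₃' hs₁ hs₂' hs₃ hs₄ hs₅ hs₆ hs₇ hprod8 hα70 hcA0 hcA12 hcA13 hCblo hCllo hCbρ hClB hσ hδ hω hτ₀ hbudgetσ hm hm₀ hr hCb₀ hCl₀ hwin hcsB
    (hT4 F hF n K hnK ρ S M _ rfl hM hS a₅ Cr ε₀ ε₁ hCr h12 hε₁ hε₀ hε₀a hCrε hw hroom V hV U hU x₀ 0 le_rfl hM'z _ rfl α₁ α₄ cstar hα₁def hcdef hα₄def a₆₆ hsdef)
    hSB9m hα₀9 hcs9 (hSLet F n K hnK _ _)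
    (hH42 F hF n K hnK ρ S M _ rfl hM hS a₅ Cr ε₀ ε₁ hCr h12 hε₁ hε₀ hε₀a hCrε hw hroom V hV U hU x₀ 0 le_rfl hM'z _ rfl α₁ α₄ cstar hα₁def hcdef hα₄def)
    (hH59 F hF n K hnK ρ S M _ rfl hM hS a₅ Cr ε₀ ε₁ hCr h12 hε₁ hε₀ hε₀a hCrε hw hroom V hV U hU x₀ 0 le_rfl hM'z _ rfl α₁ α₄ cstar hα₁def hcdef hα₄def)

end Summit.QuantumFields.YangMills.Theorems.HalvingHMemberPackStepOfSockets

end
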